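import Literature.AlgebraicTopology.SingularHomology.StratumLocalClassCharts
import Literature.AlgebraicTopology.SingularHomology.DiscAnnulusHomology
import HarnessLib

/-!
# `Hₙ(D, ∂D) ≅ Hₙ(D | p)` for an interior point `p` of a closed cell `D`

Topic `Literature/AlgebraicTopology/SingularHomology`; a brick for the fact seat
`provefact-Literature.Topology.FourManifolds.Cobordism.Milnor1965_exists_isolatedPair_middle`
(one-slide step of Milnor's Basis Theorem 7.6 on a slab, *Lectures on the h-cobordism theorem*
(1965), PDF pp. 50–52).  In the tree's statement of Thm. 7.6 the basis elements are the images of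
classes `γ ∈ Hₖ(D_L(p), S_L(p))` of the left-hand discs; Milnor's coefficients `D_R(p_j) · D` are
read off from the localisations of these classes at the right-hand discs
(`…StratumLocalClassCharts`, `…LocalisationInjective`), which only see the germ of the disc at
the intersection point: the map of pairs `(D, ∂D) → (W, W ∖ D_R)` factors through
`(D, D ∖ p)`.  This file supplies the comparison `Hₙ(D, ∂D) → Hₙ(D | p) = Hₙ(D, D ∖ p)`
(A. Hatcher, *Algebraic Topology* (2002), Example 2.17 / proof of Prop. 2.22, and §3.3 p. 236:
*"`Hₙ(M | x) ≅ Hₙ(Dⁿ, ∂Dⁿ)` for a closed disc neighbourhood"*):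

* `isStrongDeformationRetractOf_sphere_closedBall_diff_zero` — the boundary sphere is a strong
  deformation retract of the punctured closed ball (radial deformation, Hatcher Ch. 0 p. 2);
* `isIso_map_closedBall_sphere_compl_zero` — `Hₙ(B̄, ∂B̄) ≅ Hₙ(B̄ | 0)` (exact sequence of the
  triple `∂B̄ ⊆ B̄ ∖ 0 ⊆ B̄`);
* `exists_homeomorph_closedBall_apply_zero_eq` — a homeomorphism of `B̄(0, b)` onto itself
  fixing the boundary sphere pointwise and taking the centre to a prescribed interior point `c`
  (`v ↦ v + (1 - ‖v‖/b) c`), whence `isIso_map_closedBall_sphere_compl` — `Hₙ(B̄, ∂B̄) ≅ Hₙ(B̄ | c)`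
  for every interior point `c`;
* **`bijective_map_parametrizedDisc_boundary_compl`** — for a parametrized closed disc
  `D = m(B̄(0, b))` in a Hausdorff space of any universe (`m` continuous and injective on the
  ball), with boundary `∂D = m(∂B̄)` and an interior point `p = m c`, the map
  `Hₙ(D, ∂D) → Hₙ(D | p)` is bijective (transport across universes, `…UniverseTransportIso`);
  hence it carries generators to generators (`isGenerator_map_parametrizedDisc_boundary_compl`),
  and the class of `(D, ∂D) → (Z, Z ∖ P)` is the image of the localised generator
  (`map_subsetIncl_boundary_eq`).

Everything is proved; no definitions, no named facts.

## References

* J. Milnor, *Lectures on the h-cobordism theorem*, notes by L. Siebenmann and J. Sondow,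
  Princeton Mathematical Notes (1965), proof of Thm. 7.6 (PDF pp. 50–52).  Held:
  `lit read book:milnornd-lectures-h-cobordism-theorem`. [MilnorHCobordism1965]
* A. Hatcher, *Algebraic Topology*, CUP 2002, Ch. 0 p. 2, §2.1 Example 2.17 and p. 118,
  §3.3 p. 236. [HatcherAT2002]
-/

noncomputable section

open CategoryTheory Limits Set Function Topology Metric Filter
open Literature.AlgebraicTopology.Homotopy

universe u v w

namespace Literature.AlgebraicTopology.SingularHomology

variable (R : Type v) [CommRing R] (M : Type v) [AddCommGroup M] [Module R M]

/-! ### The punctured closed ball retracts onto its boundary sphere -/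

section Punctured

variable {E : Type u} [NormedAddCommGroup E] [NormedSpace ℝ E]

/-- **The boundary sphere is a strong deformation retract of the punctured closed ball**
`B̄(0, b) ∖ {0}`, `0 < b`, by the radial deformation `(t, x) ↦ ((1 - t) + t b/‖x‖) x`
(Hatcher 2002, Ch. 0 p. 2; Example 2.17). [cite: HatcherAT2002, Ch. 0, p. 2] -/
theorem isStrongDeformationRetractOf_sphere_closedBall_diff_zero {b : ℝ} (hb : 0 < b) :
    IsStrongDeformationRetractOf (sphere (0 : E) b) (closedBall (0 : E) b \ {0}) := by
  refine IsStrongDeformationRetractOf.of_continuousOn (annulusDeformation b) ?_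
    (fun t ht x hx => ?_) (fun x _ => ?_) (fun x hx => ?_) (fun t _ x hx hxb => ?_)
  · refine ContinuousOn.smul ?_ continuousOn_snd
    refine (continuousOn_const.sub continuousOn_fst).add (continuousOn_fst.mul
      (continuousOn_const.div (continuous_norm.comp_continuousOn continuousOn_snd) fun p hp => ?_))
    exact norm_ne_zero_iff.2 hp.2.2
  · have hx0 : 0 < ‖x‖ := norm_pos_iff.2 hx.2
    have hxb : ‖x‖ ≤ b := mem_closedBall_zero_iff.1 hx.1
    have hn := norm_annulusDeformation hx0 hb.le ht le_rfl
    have hpos : 0 < (1 - t) * ‖x‖ + t * b := by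
      rcases eq_or_lt_of_le ht.1 with h0 | h0
      · rw [← h0]; simp [hx0]
      · nlinarith [ht.2, hx0]
    refine ⟨mem_closedBall_zero_iff.2 ?_, fun h0 => ?_⟩
    · rw [hn]; nlinarith [ht.1, ht.2]
    · rw [mem_singleton_iff] at h0
      rw [h0, norm_zero] at hn
      linarith
  · simp [annulusDeformation]
  · have hx0 : 0 < ‖x‖ := norm_pos_iff.2 hx.2
    rw [mem_sphere_zero_iff_norm, norm_annulusDeformation hx0 hb.le ⟨zero_le_one, le_rfl⟩ le_rfl]
    ring
  · rw [mem_sphere_zero_iff_norm] at hxb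
    have hx0 : ‖x‖ ≠ 0 := by rw [hxb]; exact hb.ne'
    rw [annulusDeformation, hxb, div_self (hxb ▸ hx0), mul_one, sub_add_cancel, one_smul]

/-- `H⁎(B̄(0, b) ∖ 0, ∂B̄) = 0`. [cite: HatcherAT2002, §2.1 Example 2.17 (with Ch. 0, p. 2)] -/
theorem isZero_relativeSingularHomology_closedBall_diff_zero_sphere {b : ℝ} (hb : 0 < b) (n : ℕ) :
    IsZero (relativeSingularHomology R M (↥(closedBall (0 : E) b \ {0}))
      (Subtype.val ⁻¹' sphere (0 : E) b) n) :=
  (isStrongDeformationRetractOf_sphere_closedBall_diff_zero hb).isZero_relativeSingularHomology R M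
    (fun x hx => ⟨sphere_subset_closedBall hx, fun h0 => hb.ne' (by
      rw [mem_singleton_iff] at h0; rw [mem_sphere_zero_iff_norm, h0, norm_zero] at hx; exact hx.symm)⟩) n

/-- **`Hₙ(B̄, ∂B̄) ≅ Hₙ(B̄ | 0)`**: for the closed ball `B̄ = B̄(0, b)`, `0 < b`, the map of pairs
`(B̄, ∂B̄) → (B̄, B̄ ∖ 0)` given by the identity induces isomorphisms (exact sequence of the
triple; `H⁎(B̄ ∖ 0, ∂B̄) = 0`).  Hatcher 2002, §3.3 p. 236: `Hₙ(M | x) ≅ Hₙ(Dⁿ, ∂Dⁿ)`.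
[cite: HatcherAT2002, §3.3 p. 236; §2.1 p. 118] -/
theorem isIso_map_closedBall_sphere_compl_zero {b : ℝ} (hb : 0 < b) (n : ℕ)
    (h : MapsTo (ContinuousMap.id ↥(closedBall (0 : E) b))
      (Subtype.val ⁻¹' sphere (0 : E) b)
      {(⟨0, mem_closedBall_self hb.le⟩ : ↥(closedBall (0 : E) b))}ᶜ) :
    IsIso (relativeSingularHomology.map R M (ContinuousMap.id ↥(closedBall (0 : E) b)) h n) := by
  -- `{0}ᶜ` in the closed ball is the trace of `B̄ ∖ {0}`
  have hA : ({(⟨0, mem_closedBall_self hb.le⟩ : ↥(closedBall (0 : E) b))}ᶜ :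
      Set ↥(closedBall (0 : E) b)) = Subtype.val ⁻¹' (closedBall (0 : E) b \ {0}) := by
    ext x
    simp only [mem_compl_iff, mem_singleton_iff, mem_preimage, Set.mem_sdiff, Subtype.ext_iff]
    exact ⟨fun hx => ⟨x.2, hx⟩, fun hx => hx.2⟩
  have hsub : (Subtype.val ⁻¹' sphere (0 : E) b : Set ↥(closedBall (0 : E) b)) ⊆
      Subtype.val ⁻¹' (closedBall (0 : E) b \ {0}) := fun x hx => hA ▸ h hx
  -- vanishing of `H⁎(B̄ ∖ 0, ∂B̄)` transported to the subspace of the ball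
  have hz : ∀ i, IsZero (relativeSingularHomology R M
      (↥(Subtype.val ⁻¹' (closedBall (0 : E) b \ {0}) : Set ↥(closedBall (0 : E) b)))
      (Subtype.val ⁻¹' (Subtype.val ⁻¹' sphere (0 : E) b)) i) := by
    intro i
    exact (relativeSingularHomology.isZero_iff_of_homeomorph R M
      (preimageValHomeomorphOfSubset (sdiff_subset : closedBall (0 : E) b \ {0} ⊆ closedBall 0 b))
      (A := Subtype.val ⁻¹' (Subtype.val ⁻¹' sphere (0 : E) b))
      (B := Subtype.val ⁻¹' sphere (0 : E) b) (fun x hx => hx) (fun x hx => hx) i).2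
      (isZero_relativeSingularHomology_closedBall_diff_zero_sphere R M hb i)
  haveI := relativeSingularHomology.isIso_map_of_isZero R M hsub hz n
  haveI := relativeSingularHomology.isIso_map_id_of_eq R M hA.symm
    (fun x hx => hA.symm ▸ hx) n
  have hfac : relativeSingularHomology.map R M (ContinuousMap.id ↥(closedBall (0 : E) b)) h n =
      relativeSingularHomology.map R M (ContinuousMap.id _)
        (mapsTo_id_of_subset hsub) n ≫
      relativeSingularHomology.map R M (ContinuousMap.id _) (fun x hx => hA.symm ▸ hx) n := by
    rw [← relativeSingularHomology.map_comp]
    rfl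
  rw [hfac]
  infer_instance

end Punctured

/-! ### Moving the centre to an interior point, fixing the boundary -/

section MoveCentre

variable {E : Type u} [NormedAddCommGroup E] [NormedSpace ℝ E]

/-- **A homeomorphism of the closed ball fixing the boundary sphere and moving the centre to a
prescribed interior point**: `v ↦ v + (1 - ‖v‖/b) c` is a continuous bijection of the compact
ball `B̄(0, b)` (injective since `‖c‖ < b`, onto by the intermediate value theorem along
`r ↦ ‖w - (1 - r/b) c‖ - r`). [folklore] -/
theorem exists_homeomorph_closedBall_apply_zero_eq [ProperSpace E] {b : ℝ} (hb : 0 < b) {c : E}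
    (hc : c ∈ ball (0 : E) b) :
    ∃ T : ↥(closedBall (0 : E) b) ≃ₜ ↥(closedBall (0 : E) b),
      (T ⟨0, mem_closedBall_self hb.le⟩ : E) = c ∧
      ∀ v : ↥(closedBall (0 : E) b), (v : E) ∈ sphere (0 : E) b → T v = v := by
  have hcb : ‖c‖ < b := mem_ball_zero_iff.1 hc
  haveI : CompactSpace ↥(closedBall (0 : E) b) :=
    isCompact_iff_compactSpace.mp (isCompact_closedBall 0 b)
  -- the map
  let g : E → E := fun v => v + (1 - ‖v‖ / b) • c
  have hg_mem : ∀ v ∈ closedBall (0 : E) b, g v ∈ closedBall (0 : E) b := by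
    intro v hv
    rw [mem_closedBall_zero_iff] at hv ⊢
    have h1 : 0 ≤ 1 - ‖v‖ / b := by
      rw [sub_nonneg, div_le_one hb]; exact hv
    calc ‖v + (1 - ‖v‖ / b) • c‖ ≤ ‖v‖ + ‖(1 - ‖v‖ / b) • c‖ := norm_add_le _ _
      _ = ‖v‖ + (1 - ‖v‖ / b) * ‖c‖ := by rw [norm_smul, Real.norm_of_nonneg h1]
      _ ≤ ‖v‖ + (1 - ‖v‖ / b) * b := by gcongr
      _ = b := by field_simp; ring
  have hg_cont : Continuous g := by fun_prop
  have hg_inj : InjOn g (closedBall (0 : E) b) := by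
    intro v _ w _ hvw
    have h1 : v - w = ((‖v‖ - ‖w‖) / b) • c := by
      have : v + (1 - ‖v‖ / b) • c = w + (1 - ‖w‖ / b) • c := hvw
      rw [sub_eq_iff_eq_add]
      calc v = w + (1 - ‖w‖ / b) • c - (1 - ‖v‖ / b) • c := by rw [← this, add_sub_cancel_right]
        _ = ((‖v‖ - ‖w‖) / b) • c + w := by rw [add_sub_assoc, ← sub_smul, add_comm]; congr 1; ring_nf
    have h2 : ‖v - w‖ ≤ ‖v - w‖ * (‖c‖ / b) := by
      calc ‖v - w‖ = |‖v‖ - ‖w‖| / b * ‖c‖ := by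
            rw [h1, norm_smul, Real.norm_eq_abs, abs_div, abs_of_pos hb]
        _ ≤ ‖v - w‖ / b * ‖c‖ := by gcongr; exact abs_norm_sub_norm_le v w
        _ = ‖v - w‖ * (‖c‖ / b) := by ring
    have h3 : ‖c‖ / b < 1 := (div_lt_one hb).2 hcb
    have h4 : ‖v - w‖ = 0 := by
      nlinarith [norm_nonneg (v - w), h2, h3]
    exact sub_eq_zero.1 (norm_eq_zero.1 h4)
  have hg_surj : ∀ w ∈ closedBall (0 : E) b, ∃ v ∈ closedBall (0 : E) b, g v = w := by
    intro w hw
    rw [mem_closedBall_zero_iff] at hw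
    -- intermediate value theorem for `r ↦ ‖w - (1 - r/b) c‖ - r` on `[0, b]`
    have hcont : Continuous fun r : ℝ => ‖w - (1 - r / b) • c‖ - r := by fun_prop
    have h0 : 0 ≤ ‖w - (1 - 0 / b) • c‖ - 0 := by simp
    have h1 : ‖w - (1 - b / b) • c‖ - b ≤ 0 := by
      rw [div_self hb.ne', sub_self, zero_smul, sub_zero, sub_nonpos]; exact hw
    obtain ⟨r, hr, hr0⟩ := intermediate_value_Icc' hb.le hcont.continuousOn ⟨h1, h0⟩
    have hnorm : ‖w - (1 - r / b) • c‖ = r := by linarith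
    refine ⟨w - (1 - r / b) • c, mem_closedBall_zero_iff.2 (hnorm ▸ hr.2 |>.trans_eq' rfl |> fun h => ?_), ?_⟩
    · rw [hnorm]; exact hr.2
    · change w - (1 - r / b) • c + (1 - ‖w - (1 - r / b) • c‖ / b) • c = w
      rw [hnorm, sub_add_cancel]
  -- the homeomorphism
  let g' : ↥(closedBall (0 : E) b) → ↥(closedBall (0 : E) b) := fun v => ⟨g v, hg_mem v v.2⟩
  have hbij : Bijective g' := by
    refine ⟨fun v w hvw => Subtype.ext (hg_inj v.2 w.2 (congrArg Subtype.val hvw)), fun w => ?_⟩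
    obtain ⟨v, hv, hvw⟩ := hg_surj w w.2
    exact ⟨⟨v, hv⟩, Subtype.ext hvw⟩
  have hcont' : Continuous g' := (hg_cont.comp continuous_subtype_val).subtype_mk _
  refine ⟨hcont'.homeoOfEquivCompactToT2 (f := Equiv.ofBijective g' hbij), ?_, fun v hv => ?_⟩
  · change g 0 = c
    simp [g]
  · apply Subtype.ext
    change g v = v
    rw [mem_sphere_zero_iff_norm] at hv
    simp only [g, hv, div_self hb.ne', sub_self, zero_smul, add_zero]

/-- **`Hₙ(B̄, ∂B̄) ≅ Hₙ(B̄ | c)` for every interior point `c`** of the closed ball `B̄(0, b)` of a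
proper (e.g. finite-dimensional) real normed space: conjugate the case of the centre
(`isIso_map_closedBall_sphere_compl_zero`) by a homeomorphism of the ball fixing the boundary and
taking `0` to `c`. [cite: HatcherAT2002, §3.3 p. 236; §2.1 p. 118] -/
theorem isIso_map_closedBall_sphere_compl [ProperSpace E] {b : ℝ} (hb : 0 < b) {c : E}
    (hc : c ∈ ball (0 : E) b) (n : ℕ)
    (h : MapsTo (ContinuousMap.id ↥(closedBall (0 : E) b)) (Subtype.val ⁻¹' sphere (0 : E) b)
      {(⟨c, ball_subset_closedBall hc⟩ : ↥(closedBall (0 : E) b))}ᶜ) :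
    IsIso (relativeSingularHomology.map R M (ContinuousMap.id ↥(closedBall (0 : E) b)) h n) := by
  obtain ⟨T, hT0, hTfix⟩ := exists_homeomorph_closedBall_apply_zero_eq hb hc
  have hT0' : T ⟨0, mem_closedBall_self hb.le⟩ = ⟨c, ball_subset_closedBall hc⟩ := Subtype.ext hT0
  -- `T` as a map of the pairs `(B̄, ∂B̄) → (B̄, ∂B̄)` and `(B̄, B̄ ∖ 0) → (B̄, B̄ ∖ c)`
  have hTS : MapsTo (T : C(↥(closedBall (0 : E) b), ↥(closedBall (0 : E) b)))
      (Subtype.val ⁻¹' sphere (0 : E) b) (Subtype.val ⁻¹' sphere (0 : E) b) := by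
    intro v hv
    change ((T v : E)) ∈ sphere (0 : E) b
    rw [hTfix v hv]
    exact hv
  have hTp : MapsTo (T : C(↥(closedBall (0 : E) b), ↥(closedBall (0 : E) b)))
      {(⟨0, mem_closedBall_self hb.le⟩ : ↥(closedBall (0 : E) b))}ᶜ
      {(⟨c, ball_subset_closedBall hc⟩ : ↥(closedBall (0 : E) b))}ᶜ := by
    intro v hv hv'
    apply hv
    rw [mem_singleton_iff] at hv' ⊢
    apply T.injective
    change T v = _ at hv'
    rw [hv', hT0']
  have h₀ : MapsTo (ContinuousMap.id ↥(closedBall (0 : E) b)) (Subtype.val ⁻¹' sphere (0 : E) b)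
      {(⟨0, mem_closedBall_self hb.le⟩ : ↥(closedBall (0 : E) b))}ᶜ := by
    intro v hv hv0
    rw [mem_singleton_iff] at hv0
    have hv0' : v = ⟨0, mem_closedBall_self hb.le⟩ := hv0
    have : ((v : E)) ∈ sphere (0 : E) b := hv
    rw [hv0'] at this
    change (0 : E) ∈ sphere (0 : E) b at this
    rw [mem_sphere_zero_iff_norm, norm_zero] at this
    exact hb.ne' this.symm
  -- the commuting square `id ∘ T = T ∘ id`
  have hsq : relativeSingularHomology.map R M
        (T : C(↥(closedBall (0 : E) b), ↥(closedBall (0 : E) b))) hTS n ≫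
      relativeSingularHomology.map R M (ContinuousMap.id ↥(closedBall (0 : E) b)) h n =
      relativeSingularHomology.map R M (ContinuousMap.id ↥(closedBall (0 : E) b)) h₀ n ≫
      relativeSingularHomology.map R M
        (T : C(↥(closedBall (0 : E) b), ↥(closedBall (0 : E) b))) hTp n := by
    rw [← relativeSingularHomology.map_comp, ← relativeSingularHomology.map_comp]
    rfl
  have hTfix' : ∀ v : ↥(closedBall (0 : E) b), (v : E) ∈ sphere (0 : E) b → T.symm v = v := by
    intro v hv
    rw [Homeomorph.symm_apply_eq]
    exact (hTfix v hv).symm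
  have hTS' : MapsTo (T.symm : C(↥(closedBall (0 : E) b), ↥(closedBall (0 : E) b)))
      (Subtype.val ⁻¹' sphere (0 : E) b) (Subtype.val ⁻¹' sphere (0 : E) b) := by
    intro v hv
    change ((T.symm v : E)) ∈ sphere (0 : E) b
    rw [hTfix' v hv]
    exact hv
  have hTp' : MapsTo (T.symm : C(↥(closedBall (0 : E) b), ↥(closedBall (0 : E) b)))
      {(⟨c, ball_subset_closedBall hc⟩ : ↥(closedBall (0 : E) b))}ᶜ
      {(⟨0, mem_closedBall_self hb.le⟩ : ↥(closedBall (0 : E) b))}ᶜ := by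
    intro v hv hv'
    apply hv
    rw [mem_singleton_iff] at hv' ⊢
    change T.symm v = _ at hv'
    rw [← T.apply_symm_apply v, hv', hT0']
  haveI := relativeSingularHomology.isIso_map_homeomorph R M T hTS hTS' n
  haveI := relativeSingularHomology.isIso_map_homeomorph R M T hTp hTp' n
  haveI := isIso_map_closedBall_sphere_compl_zero R M hb n h₀
  haveI : IsIso (relativeSingularHomology.map R M (ContinuousMap.id ↥(closedBall (0 : E) b)) h₀ n ≫
      relativeSingularHomology.map R M
        (T : C(↥(closedBall (0 : E) b), ↥(closedBall (0 : E) b))) hTp n) := IsIso.comp_isIso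
  exact IsIso.of_isIso_fac_left hsq

end MoveCentre

/-! ### Parametrized closed discs in a space of any universe -/

section Parametrized

variable {k : ℕ} {Z : Type w} [TopologicalSpace Z] [T2Space Z]

/-- **`Hₙ(D, ∂D) → Hₙ(D | p)` is bijective for a parametrized closed `k`-disc** `D = m(B̄(0, b))`
of a Hausdorff space `Z` (any universe), `m` continuous and injective on the closed ball of
`ℝᵏ`, `∂D = m(∂B̄)`, `p = m c` an interior point: transport of
`isIso_map_closedBall_sphere_compl` along the homeomorphism `B̄ ≃ D` across universes
(`relativeSingularHomology.xEquiv_map`).  Hatcher 2002, §3.3 p. 236: `Hₙ(M | x) ≅ Hₙ(Dⁿ, ∂Dⁿ)`.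
[cite: HatcherAT2002, §3.3 p. 236; §2.1 p. 118] -/
theorem bijective_map_parametrizedDisc_boundary_compl (m : EuclideanSpace ℝ (Fin k) → Z) {b : ℝ} (hb : 0 < b)
    (hmc : ContinuousOn m (closedBall 0 b)) (hmi : InjOn m (closedBall 0 b)) {c : EuclideanSpace ℝ (Fin k)}
    (hc : c ∈ ball 0 b) (n : ℕ)
    (h : MapsTo (ContinuousMap.id ↥(m '' closedBall 0 b)) (Subtype.val ⁻¹' (m '' sphere 0 b))
      {(⟨m c, mem_image_of_mem m (ball_subset_closedBall hc)⟩ : ↥(m '' closedBall 0 b))}ᶜ) :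
    Bijective (relativeSingularHomology.map R M (ContinuousMap.id ↥(m '' closedBall 0 b)) h n) := by
  obtain ⟨e, he⟩ := exists_homeomorph_image_closedBall m hmc hmi
  have hec : e ⟨c, ball_subset_closedBall hc⟩ = ⟨m c, mem_image_of_mem m (ball_subset_closedBall hc)⟩ :=
    Subtype.ext (he _)
  -- the map of the model
  have h₀ : MapsTo (ContinuousMap.id ↥(closedBall (0 : EuclideanSpace ℝ (Fin k)) b)) (Subtype.val ⁻¹' sphere (0 : EuclideanSpace ℝ (Fin k)) b)
      {(⟨c, ball_subset_closedBall hc⟩ : ↥(closedBall (0 : EuclideanSpace ℝ (Fin k)) b))}ᶜ := by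
    intro v hv hvc
    rw [mem_singleton_iff] at hvc
    have hvc' : v = ⟨c, ball_subset_closedBall hc⟩ := hvc
    have hvs : ((v : EuclideanSpace ℝ (Fin k))) ∈ sphere (0 : EuclideanSpace ℝ (Fin k)) b := hv
    rw [hvc'] at hvs
    change c ∈ sphere (0 : EuclideanSpace ℝ (Fin k)) b at hvs
    rw [mem_sphere_zero_iff_norm] at hvs
    rw [mem_ball_zero_iff] at hc
    exact hc.ne hvs
  haveI := isIso_map_closedBall_sphere_compl R M hb hc n h₀
  have hbij₀ := (asIso (relativeSingularHomology.map R M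
    (ContinuousMap.id ↥(closedBall (0 : EuclideanSpace ℝ (Fin k)) b)) h₀ n)).toLinearEquiv.bijective
  -- the pairs along `e`
  have hAB : MapsTo e (Subtype.val ⁻¹' sphere (0 : EuclideanSpace ℝ (Fin k)) b) (Subtype.val ⁻¹' (m '' sphere 0 b)) := by
    intro v hv
    change ((e v : Z)) ∈ m '' sphere 0 b
    rw [he]
    exact mem_image_of_mem m hv
  have hBA : MapsTo e.symm (Subtype.val ⁻¹' (m '' sphere 0 b)) (Subtype.val ⁻¹' sphere (0 : EuclideanSpace ℝ (Fin k)) b) := by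
    intro y hy
    obtain ⟨s, hs, hsy⟩ := (hy : (y : Z) ∈ m '' sphere 0 b)
    have h1 : m (e.symm y) = m s := by rw [← he, e.apply_symm_apply, hsy]
    have h2 : ((e.symm y : EuclideanSpace ℝ (Fin k))) = s := hmi (e.symm y).2 (sphere_subset_closedBall hs) h1
    change ((e.symm y : EuclideanSpace ℝ (Fin k))) ∈ sphere (0 : EuclideanSpace ℝ (Fin k)) b
    rw [h2]
    exact hs
  have hAB₂ : MapsTo e {(⟨c, ball_subset_closedBall hc⟩ : ↥(closedBall (0 : EuclideanSpace ℝ (Fin k)) b))}ᶜ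
      {(⟨m c, mem_image_of_mem m (ball_subset_closedBall hc)⟩ : ↥(m '' closedBall 0 b))}ᶜ := by
    intro v hv h1
    apply hv
    rw [mem_singleton_iff] at h1 ⊢
    apply e.injective
    rw [h1, hec]
  have hBA₂ : MapsTo e.symm
      {(⟨m c, mem_image_of_mem m (ball_subset_closedBall hc)⟩ : ↥(m '' closedBall 0 b))}ᶜ
      {(⟨c, ball_subset_closedBall hc⟩ : ↥(closedBall (0 : EuclideanSpace ℝ (Fin k)) b))}ᶜ := by
    intro y hy h1
    apply hy
    rw [mem_singleton_iff] at h1 ⊢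
    rw [← e.apply_symm_apply y, h1, hec]
  -- naturality of the transport for the square `id ∘ e = e ∘ id`
  have hnat := fun x => relativeSingularHomology.xEquiv_map R M e e
    (ContinuousMap.id ↥(closedBall (0 : EuclideanSpace ℝ (Fin k)) b)) (ContinuousMap.id ↥(m '' closedBall 0 b))
    (fun _ => rfl) hAB hBA hAB₂ hBA₂ h₀ h n x
  have heq : ⇑(relativeSingularHomology.map R M (ContinuousMap.id ↥(m '' closedBall 0 b)) h n) =
      relativeSingularHomology.xEquiv R M e hAB₂ hBA₂ n ∘
        relativeSingularHomology.map R M (ContinuousMap.id ↥(closedBall (0 : EuclideanSpace ℝ (Fin k)) b)) h₀ n ∘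
        (relativeSingularHomology.xEquiv R M e hAB hBA n).symm := by
    funext y
    simp only [comp_apply]
    conv_lhs => rw [← (relativeSingularHomology.xEquiv R M e hAB hBA n).apply_symm_apply y]
    exact (hnat _).symm
  rw [heq]
  exact (relativeSingularHomology.xEquiv R M e hAB₂ hBA₂ n).bijective.comp
    (hbij₀.comp (relativeSingularHomology.xEquiv R M e hAB hBA n).symm.bijective)

/-- **Generators of `Hₖ(D, ∂D; ℤ)` localise to generators of `Hₖ(D | p; ℤ)`** (`p` an interior
point of the parametrized disc `D`). [cite: HatcherAT2002, §3.3 p. 236] -/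
theorem isGenerator_map_parametrizedDisc_boundary_compl (m : EuclideanSpace ℝ (Fin k) → Z) {b : ℝ} (hb : 0 < b)
    (hmc : ContinuousOn m (closedBall 0 b)) (hmi : InjOn m (closedBall 0 b)) {c : EuclideanSpace ℝ (Fin k)}
    (hc : c ∈ ball 0 b) (n : ℕ)
    (h : MapsTo (ContinuousMap.id ↥(m '' closedBall 0 b)) (Subtype.val ⁻¹' (m '' sphere 0 b))
      {(⟨m c, mem_image_of_mem m (ball_subset_closedBall hc)⟩ : ↥(m '' closedBall 0 b))}ᶜ)
    {γ : relativeSingularHomology ℤ ℤ ↥(m '' closedBall 0 b) (Subtype.val ⁻¹' (m '' sphere 0 b)) n}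
    (hγ : ∃ e : _ ≃ₗ[ℤ] ℤ, e γ = 1) :
    ∃ e : _ ≃ₗ[ℤ] ℤ, e (relativeSingularHomology.map ℤ ℤ
      (ContinuousMap.id ↥(m '' closedBall 0 b)) h n γ) = 1 :=
  exists_linearEquiv_apply_eq_one_of_linearEquiv
    (LinearEquiv.ofBijective (relativeSingularHomology.map ℤ ℤ
      (ContinuousMap.id ↥(m '' closedBall 0 b)) h n).hom
      (bijective_map_parametrizedDisc_boundary_compl ℤ ℤ m hb hmc hmi hc n h)) hγ

omit [T2Space Z] in
/-- **The class of `(D, ∂D) → (Z, Z ∖ P)` only depends on the germ of `D` at `p`**: if `D` meets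
`P` at most in `p` (and `∂D` misses `P`), the map of pairs `(D, ∂D) → (Z, Z ∖ P)` factors
through the localisation `(D, ∂D) → (D, D ∖ p)` (functoriality).  With
`isGenerator_map_parametrizedDisc_boundary_compl` and
`exists_ref_forall_transverseDisc` (`…StratumLocalClassCharts`) this computes the images of
the disc classes of Milnor's Thm. 7.6 at the right-hand discs. [cite: MilnorHCobordism1965, proof of Thm. 7.6 (PDF p. 50); HatcherAT2002, §2.1] -/
theorem map_subsetIncl_boundary_eq {D : Set Z} {S : Set ↥D} {p : ↥D} {P : Set Z}
    (hS : MapsTo (subsetIncl D) S Pᶜ) (hp : MapsTo (subsetIncl D) {p}ᶜ Pᶜ)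
    (h : MapsTo (ContinuousMap.id ↥D) S {p}ᶜ) (n : ℕ)
    (γ : relativeSingularHomology R M ↥D S n) :
    relativeSingularHomology.map R M (subsetIncl D) hS n γ =
      relativeSingularHomology.map R M (subsetIncl D) hp n
        (relativeSingularHomology.map R M (ContinuousMap.id ↥D) h n γ) := by
  rw [← ModuleCat.comp_apply, ← relativeSingularHomology.map_comp]
  rfl

end Parametrized

end Literature.AlgebraicTopology.SingularHomology

end
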